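import Summits.ResolutionOfSingularities.ResolutionOfSingularities.Theorems.EquisingularLiftEquisingularLiftNatTowerInvDefs
import Summits.ResolutionOfSingularities.ResolutionOfSingularities.Theorems.EquisingularLiftEquisingularLiftNatExceptionalReducedModel
import Summits.ResolutionOfSingularities.ResolutionOfSingularities.Theorems.EquisingularLiftEquisingularLiftNatRegularPointStepExact
import Literature.AlgebraicGeometry.Resolution.ExceptionalDivisorRegularGlobal
import Literature.AlgebraicGeometry.Resolution.RegularQuotientIdeal
import Literature.AlgebraicGeometry.Resolution.BlowupChartMembership
import Literature.AlgebraicGeometry.Resolution.NearPointsSigmaLocal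
import HarnessLib

/-!
# [OURS · L1 W4.5(b) · EL♮(3)] HSUB′(ReachNoseTower₃) — THE SEED OF THE NOSE TOWER: `Tower.Inv₂` on the nose seed
# (driver `hsub_reachNoseTower₃_of_invariant` …NatNoseTowerDriverThree p564786, clause (seed); invariant …NatTowerInvDefs p556392)

res-D-pv-035 g8 (W4.5b NOSETOWER₃ ASSEMBLER; custody res-plan-2 DEAL #58 (2), res-L1-w45b-plan-1 GO 2026-08-27T19:55:25Z). OURS; NOT a statement of
any manuscript; AI-written, weaker than expert review. No `sorry`; standard axioms. DEF-FREE. `--supports stmt-ResolutionOfSingularities-20148 --as helper`.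

WHAT. `Tower.inv₂_noseSeed`: in the NOSE block of HSUB′(ReachNoseTower₃) (text of record `HSUB-RATNOSETOWER3.sig.txt` cad6759341cbb034: a
`Ch`-stage `(X', σ', S')` with model square `j : F₁ → X'` over `Spec θ` and `j '' T₁ = S'`; a closed infinite `Z ⊊ T₁`; a regular `O`-flat centre
`C ⊂ X'` with exact trace `C·𝒪_{F₁} = 𝓘⟨Z⟩` off the generic point of `Y`; its blow-up `τ₁ : X₁ → X'` — integral, locally Noetherian, regular,
dominant, a `Ch`-stage on `j₂ '' closure υ⁻¹(T₁ ∖ Z)`; the downstairs blow-up `υ : F₂ → F₁` of `𝓘⟨Z⟩` with model square `j₂ : F₂ → X₁`,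
`j₂ ≫ τ₁ = υ ≫ j`) the TOWER-STAGE INVARIANT `Tower.Inv₂ O k θ P q Y Ch Ruled F₁ Z hZ F₂ υ` HOLDS ON THE NOSE SEED
`(F₂, 𝟙, closure υ⁻¹(T₁ ∖ Z), υ⁻¹ Z, ∅)` — modulo ONE named stand-in, exactly as in res-D-pv-029's curve step `Tower.inv₂_of_inv_curveStep_forget`
(…NatTowerCurveStepCartier p558664): the ruled-surface datum `Ruled` of the freshly created exceptional surface `𝓔 := C·𝒪_{X₁}` at the root
`(X', C)` (hypothesis `hRuled`; for `Ruled := DirLift.Ruled` it is res-L1-w45b-stub-2's `DirLift.ruled_root` with `ρ = 𝟙`, `ϱ = 𝟙`, `Z₀ := Z`,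
whose (R3) 2-frames pin `n = 3` and whose (R4) asks the rational root `C ≅ ℙ¹_O`). The nose blow-up IS the carrier-curve blow-up, and — unlike the
curve step — the blow-up, its model square and the next `Ch`-stage are GIVEN by the block (res-type-100's `modelStep` on the closer's side), so the
proof is 029's with the construction deleted: (e-i) EXACT REDUCED TRACE `𝓔·𝒪_{F₂} = 𝓘⟨υ⁻¹Z⟩` by res-D-pv-029's model-square lemma
`comap_comap_eq_vanishingIdeal_preimage_of_model` (…NatExceptionalReducedModel; quasi-regular frames of `C` at the special points from Literature
`exists_isQuasiRegular_span_eq_of_isRegularLocalRing_quotient`, the regular quotient stalks from `Scheme.IsRegular C.subscheme` via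
`isRegularLocalRing_quotient_stalkIdeal_of_subschemePoint` …NatRegularPointStepExact); (e-ii) locally principal (`IsBlowup.isEffectiveCartier`);
(e-iii) regular (Literature `IsBlowup.isRegular_subscheme_comap`); (e-iv) off the generic point of `Y`; (e-v) `hRuled`; shadow `∅` (`Shadow₂`'s
first disjunct — `ConeWitness` never fires on the nose); `T ⊄ E` because `υ` is onto off `Z` (Literature `IsBlowup.exists_preimage_of_not_mem_support`).
`Tower.inv₂_noseSeed'` appends res-D-pv-029's three side conjuncts `IsClosed K ∧ K ⊆ closure (K ∖ E) ∧ K ≠ univ` of the assembly's `INV₁` at `K = ∅`.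

References: res-D-pv-029 …NatTowerCurveStepCartier (p558664), …NatTowerInvDefs (p556392), …NatExceptionalReducedModel; res-D-pv-035 …NatNoseTowerDriverThree
(p564786); [cite: GortzWedhorn2020, Prop. 13.91]; [cite: Liu2002, Thm. 8.1.19].
-/

set_option linter.dupNamespace false -- mandated namespace `Summit.<Summit>.<Problem>` of this single-conjunct summit
set_option linter.overlappingInstances false -- signatures carry `[IsDomain O] [IsDiscreteValuationRing O]`

noncomputable section

open CategoryTheory CategoryTheory.Limits AlgebraicGeometry TopologicalSpace Topology IsLocalRing
open Literature.AlgebraicGeometry.Resolution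
open AlgebraicGeometry.Scheme.IdealSheafData

namespace Summit.ResolutionOfSingularities.ResolutionOfSingularities.Cruxes.EquisingularLiftNat.Sections

/-- **The nose seed carries `Tower.Inv₂`** (see the module docstring), modulo the ruled-surface datum `hRuled` of the new exceptional surface
`C·𝒪_{X₁}` at the root `(X', C)`. [cite: GortzWedhorn2020, Prop. 13.91] [cite: Liu2002, Thm. 8.1.19] [OURS · L1 W4.5b] toward
`stub_elnat_ratNoseTowerResolution` via `hsub_reachNoseTower₃_of_invariant` (seed); NOT a statement of the manuscript. -/
theorem Tower.inv₂_noseSeed (O : Type) [CommRing O] [IsDomain O] [IsDiscreteValuationRing O] (k : Type) [Field k]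
    (θ : O →+* k) (hθ : Function.Surjective θ)
    (P : Scheme.{0}) (q : P ⟶ Spec (.of O)) (Y : Set P) (Ch : ∀ X' : Scheme.{0}, (X' ⟶ P) → Set X' → Prop)
    (Ruled : Tower.RuledDatum P)
    -- the stage before the nose and its model
    (X' : Scheme.{0}) (σ' : X' ⟶ P) (hX'noeth : IsLocallyNoetherian X') (hX'reg : Scheme.IsRegular X')
    (F₁ : Scheme.{0}) (j : F₁ ⟶ X') (t : F₁ ⟶ Spec (.of k)) (hsq : IsPullback j t (σ' ≫ q) (Spec.map (CommRingCat.ofHom θ)))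
    (T₁ : Set F₁)
    -- the nose block
    (Z : Set F₁) (hZ : IsClosed Z) (hT₁Z : ¬ T₁ ⊆ Z) (hZinf : Z.Infinite)
    (C : X'.IdealSheafData) (hCreg : Scheme.IsRegular C.subscheme)
    (hCj : C.comap j = vanishingIdeal (⟨Z, hZ⟩ : Closeds F₁))
    (hCoff : ∀ c ∈ (C.support : Set X'), ¬ IsGenericPoint (σ' c) Y)
    (X₁ : Scheme.{0}) (τ₁ : X₁ ⟶ X') (hτ₁ : IsBlowup τ₁ C) (hX₁int : IsIntegral X₁) (hX₁noeth : IsLocallyNoetherian X₁)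
    (hX₁reg : Scheme.IsRegular X₁) (hX₁dom : IsDominant ((τ₁ ≫ σ') ≫ q))
    (F₂ : Scheme.{0}) (hF₂ : IsIntegral F₂) (υ : F₂ ⟶ F₁) (hυ : IsBlowup υ (vanishingIdeal (⟨Z, hZ⟩ : Closeds F₁)))
    (j₂ : F₂ ⟶ X₁) (t₂ : F₂ ⟶ Spec (.of k)) (hsq₂ : IsPullback j₂ t₂ ((τ₁ ≫ σ') ≫ q) (Spec.map (CommRingCat.ofHom θ)))
    (hcomm : j₂ ≫ τ₁ = υ ≫ j) (hirr₂ : IsIrreducible (closure (υ ⁻¹' (T₁ \ Z))))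
    (hCh₁ : Ch X₁ (τ₁ ≫ σ') (j₂ '' closure (υ ⁻¹' (T₁ \ Z))))
    -- STAND-IN (owner res-L1-w45b-stub-2 / res-type-027; `DirLift.ruled_root` at the root `(X', C)`): the ruled-surface datum of `C·𝒪_{X₁}`
    (hRuled : Ruled F₁ Z hZ F₂ υ F₂ (𝟙 F₂) (υ ⁻¹' Z) X₁ (τ₁ ≫ σ') j₂ (C.comap τ₁)) :
    Tower.Inv₂ O k θ P q Y Ch Ruled F₁ Z hZ F₂ υ F₂ (𝟙 F₂) (closure (υ ⁻¹' (T₁ \ Z))) (υ ⁻¹' Z) ∅ := by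
  classical
  haveI := hX'noeth
  haveI := hX₁noeth
  haveI := hX₁int
  haveI := hF₂
  -- the model square: `j` is a closed immersion onto the special fibre
  haveI : IsClosedImmersion (Spec.map (CommRingCat.ofHom θ)) := IsClosedImmersion.spec_of_surjective _ hθ
  haveI hjci : IsClosedImmersion j := MorphismProperty.IsStableUnderBaseChange.of_isPullback hsq.flip inferInstance
  -- support bookkeeping downstairs
  have hsuppZ : ((vanishingIdeal ⟨Z, hZ⟩ : F₁.IdealSheafData).support : Set F₁) = Z :=
    Scheme.IdealSheafData.coe_support_vanishingIdeal _
  -- a point of `F₂` off the exceptional surface, and `T ⊄ E`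
  obtain ⟨w, hwT, hwZ⟩ := Set.not_subset.mp hT₁Z
  obtain ⟨w', hw'⟩ := hυ.exists_preimage_of_not_mem_support (z := w) (by rw [hsuppZ]; exact hwZ)
  have hTE : ¬ closure (υ ⁻¹' (T₁ \ Z)) ⊆ υ ⁻¹' Z := by
    intro h
    have h1 : w' ∈ closure (υ ⁻¹' (T₁ \ Z)) :=
      subset_closure (show υ w' ∈ T₁ \ Z by rw [hw']; exact ⟨hwT, hwZ⟩)
    have h2 : υ w' ∈ Z := h h1
    rw [hw'] at h2
    exact hwZ h2
  -- regular quotient stalks of the centre (from the regular subscheme `V(C)`)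
  have hCreg_pt : ∀ x ∈ (C.support : Set X'), IsRegularLocalRing (X'.presheaf.stalk x ⧸ stalkIdeal C x) := by
    intro x hx
    have hx' : x ∈ Set.range C.subschemeι := by rw [Scheme.IdealSheafData.range_subschemeι]; exact hx
    obtain ⟨z, rfl⟩ := hx'
    exact isRegularLocalRing_quotient_stalkIdeal_of_subschemePoint C z (hCreg z)
  -- quasi-regular frames of the centre at the special points of `Z`
  have hqr : ∀ z ∈ ((⟨Z, hZ⟩ : Closeds F₁) : Set F₁), ∃ (n : ℕ) (c : Fin n → X'.presheaf.stalk (j z)),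
      Ideal.span (Set.range c) = stalkIdeal C (j z) ∧ IsQuasiRegular c := by
    intro z hz
    have hzC : j z ∈ (C.support : Set X') := by
      have h1 : z ∈ ((C.comap j).support : Set F₁) := by rw [hCj, hsuppZ]; exact hz
      rw [Scheme.IdealSheafData.support_comap] at h1
      exact h1
    haveI : IsRegularLocalRing (X'.presheaf.stalk (j z)) := hX'reg (j z)
    haveI : IsRegularLocalRing (X'.presheaf.stalk (j z) ⧸ stalkIdeal C (j z)) := hCreg_pt _ hzC
    obtain ⟨n, c, -, hc, hq, -⟩ := exists_isQuasiRegular_span_eq_of_isRegularLocalRing_quotient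
      (J := stalkIdeal C (j z)) ((mem_support_iff_stalkIdeal_le _ _).mp hzC) (stalkIdeal C (j z) : Set _) (Ideal.span_eq _)
    exact ⟨n, c, hc, hq⟩
  -- (e-i) exact reduced trace of the new exceptional surface
  have he1 : (C.comap τ₁).comap j₂ = vanishingIdeal ⟨υ ⁻¹' Z, hZ.preimage υ.continuous⟩ :=
    comap_comap_eq_vanishingIdeal_preimage_of_model O k θ hθ (σ' ≫ q) j t hsq C τ₁ hτ₁ j₂ t₂
      (by simpa only [Category.assoc] using hsq₂) υ hcomm ⟨Z, hZ⟩ hCj hqr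
  -- (e-ii) locally principal
  have he2 : ∀ z : X₁, (stalkIdeal (C.comap τ₁) z).IsPrincipal := fun z => by
    obtain ⟨u, -, hu⟩ := hτ₁.isEffectiveCartier.exists_stalkIdeal_eq_span z
    exact ⟨⟨u, by rw [hu, Ideal.submodule_span_eq]⟩⟩
  -- (e-iii) regular
  have he3 : Scheme.IsRegular (C.comap τ₁).subscheme := hτ₁.isRegular_subscheme_comap hX'reg hCreg
  -- (e-iv) off the generic point of `Y`
  have he4 : (τ₁ ≫ σ') '' ((C.comap τ₁).support : Set X₁) ⊆ {p : P | ¬ IsGenericPoint p Y} := by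
    rintro _ ⟨z, hz, rfl⟩
    rw [Scheme.IdealSheafData.support_comap] at hz
    exact hCoff (τ₁ z) hz
  -- assemble
  refine ⟨hυ, hZinf, hF₂, isClosed_closure, hirr₂, hZ.preimage υ.continuous, hTE, X₁, τ₁ ≫ σ', _, j₂, t₂, hCh₁, hX₁int, hX₁noeth,
    hX₁reg, hX₁dom, hsq₂, rfl, fun hE => Or.inr ⟨C.comap τ₁, ?_, he2, he3, he4, hRuled, Or.inl rfl⟩⟩
  exact he1

/-- **The nose seed in res-D-pv-029's assembly currency**: `Tower.Inv₂` on the nose seed together with the three side conjuncts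
`IsClosed K ∧ K ⊆ closure (K ∖ E) ∧ K ≠ univ` of the assembly's `INV₁` (`TowerAssembly.lean`), at the seed shadow `K = ∅`. [OURS · pure logic
over `Tower.inv₂_noseSeed`] -/
theorem Tower.inv₂_noseSeed' (O : Type) [CommRing O] [IsDomain O] [IsDiscreteValuationRing O] (k : Type) [Field k]
    (θ : O →+* k) (hθ : Function.Surjective θ)
    (P : Scheme.{0}) (q : P ⟶ Spec (.of O)) (Y : Set P) (Ch : ∀ X' : Scheme.{0}, (X' ⟶ P) → Set X' → Prop)
    (Ruled : Tower.RuledDatum P)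
    (X' : Scheme.{0}) (σ' : X' ⟶ P) (hX'noeth : IsLocallyNoetherian X') (hX'reg : Scheme.IsRegular X')
    (F₁ : Scheme.{0}) (j : F₁ ⟶ X') (t : F₁ ⟶ Spec (.of k)) (hsq : IsPullback j t (σ' ≫ q) (Spec.map (CommRingCat.ofHom θ)))
    (T₁ : Set F₁)
    (Z : Set F₁) (hZ : IsClosed Z) (hT₁Z : ¬ T₁ ⊆ Z) (hZinf : Z.Infinite)
    (C : X'.IdealSheafData) (hCreg : Scheme.IsRegular C.subscheme)
    (hCj : C.comap j = vanishingIdeal (⟨Z, hZ⟩ : Closeds F₁))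
    (hCoff : ∀ c ∈ (C.support : Set X'), ¬ IsGenericPoint (σ' c) Y)
    (X₁ : Scheme.{0}) (τ₁ : X₁ ⟶ X') (hτ₁ : IsBlowup τ₁ C) (hX₁int : IsIntegral X₁) (hX₁noeth : IsLocallyNoetherian X₁)
    (hX₁reg : Scheme.IsRegular X₁) (hX₁dom : IsDominant ((τ₁ ≫ σ') ≫ q))
    (F₂ : Scheme.{0}) (hF₂ : IsIntegral F₂) (υ : F₂ ⟶ F₁) (hυ : IsBlowup υ (vanishingIdeal (⟨Z, hZ⟩ : Closeds F₁)))
    (j₂ : F₂ ⟶ X₁) (t₂ : F₂ ⟶ Spec (.of k)) (hsq₂ : IsPullback j₂ t₂ ((τ₁ ≫ σ') ≫ q) (Spec.map (CommRingCat.ofHom θ)))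
    (hcomm : j₂ ≫ τ₁ = υ ≫ j) (hirr₂ : IsIrreducible (closure (υ ⁻¹' (T₁ \ Z))))
    (hCh₁ : Ch X₁ (τ₁ ≫ σ') (j₂ '' closure (υ ⁻¹' (T₁ \ Z))))
    (hRuled : Ruled F₁ Z hZ F₂ υ F₂ (𝟙 F₂) (υ ⁻¹' Z) X₁ (τ₁ ≫ σ') j₂ (C.comap τ₁)) :
    Tower.Inv₂ O k θ P q Y Ch Ruled F₁ Z hZ F₂ υ F₂ (𝟙 F₂) (closure (υ ⁻¹' (T₁ \ Z))) (υ ⁻¹' Z) ∅ ∧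
      IsClosed (∅ : Set F₂) ∧ (∅ : Set F₂) ⊆ closure (∅ \ υ ⁻¹' Z) ∧ (∅ : Set F₂) ≠ Set.univ := by
  haveI := hF₂
  refine ⟨Tower.inv₂_noseSeed O k θ hθ P q Y Ch Ruled X' σ' hX'noeth hX'reg F₁ j t hsq T₁ Z hZ hT₁Z hZinf C hCreg hCj hCoff X₁ τ₁ hτ₁
    hX₁int hX₁noeth hX₁reg hX₁dom F₂ hF₂ υ hυ j₂ t₂ hsq₂ hcomm hirr₂ hCh₁ hRuled, isClosed_empty, Set.empty_subset _, Set.empty_ne_univ⟩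

end Summit.ResolutionOfSingularities.ResolutionOfSingularities.Cruxes.EquisingularLiftNat.Sections

end
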